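import Literature.Claims.NS.GeorgievDavidi2024

/-!
# C31b `GeorgievDavidi2024` — kernel refutation AT THE STATEMENT of Theorem 4.1 (and of Theorem 4.6) of
# S. G. Georgiev & G. Davidi, Filomat 38:9 (2024) 2965–2982, §4 — by the trace of the divergence constraint at
# `t = 0`, on the kit datum `1 + sin x` AND on the authors' own Example §4.3

Cell `ns-claims` (D-0090 NS-CLAIMS SWEEP), claim C31b (sub-row of C31 `GeorgievDavidi2021`, ADJUDICATED #38);
typed skeleton `Literature.Claims.NS.GeorgievDavidi2024` (p482552, typist-4 g2). Refuter of record
ns-claims-refuter-4 (g0); §1a below is ns-claims-typist-4 g2's statement-kit vocabulary (sha16 b9f14f86a77cb075,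
adopted verbatim after an independent farm check and print read — credit theirs; §1b is their theorem re-routed
through §0); §0, §2, §3 are the refuter's. Filed
UNCHANGED by the salvage lane (conv. (b)). Text of record: the publisher PDF [GeorgievDavidi2024]
(`sources/GeorgievDavidi2024/Filomat2024-publisher-PDF/`, page texts `text/p0NN.txt`, LIT1-FILOMAT.md).
Locators (print pages): system (2) p.2965 l.25–44 («uₓ + v_y + w_z = 0 in (0, ∞) × ℝ³», data at `t = 0`);
(P1) p.2966 l.1–3; Theorem 4.1 p.2977 l.5 («Suppose that (P1) holds. Then the equations (2) has at least one
solution (u, v) ∈ (C¹([0, ∞), C²(ℝ³)))⁴.»); `X¹`-norm p.2977 l.6–37; Theorem 4.6 p.2981 l.4; Example §4.3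
p.2982 («Therefore for the functions u₀ = v₀ = w₀ = (x² + y² + z²)/(10 + x⁴ + y⁴ + z⁴) … the IVP (2) satisfies
all conditions of Theorem 4.1 and Theorem 4.6.»).

WHAT IS PROVED (closed terms; axioms `propext`, `Classical.choice`, `Quot.sound`):
* §0 `not_solvesIVP2_of_div_ne_zero` — the STRUCTURAL fact deciding the row: if `u₀ₓ + v₀_y + w₀_z ≠ 0` at one
  point, NO quadruple in the printed class solves (2) with these data: the divergence is jointly continuous on
  `[0,∞) × ℝ³` (membership in `X¹`), vanishes on `(0,∞) × ℝ³` by (2), hence at `t = 0` (`eq_zero_at_zero`), where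
  it is `u₀ₓ + v₀_y + w₀_z`. (Robust to the reading of `C¹([0,∞), C²(ℝ³))`: every standard reading makes
  `t ↦ ∂ₓu(t, x₀)` continuous at `t = 0⁺` for fixed `x₀`, which is all that is used.)
* §1 (typist-4's kit) `not_Theorem41` — the (P1)-datum `u₀ = 1 + sin x`, `v₀ = w₀ = 0`, `B = 2`: divergence
  `cos 0 = 1` at the origin.
* §2 `example_not_solvable`, `step_L14_example_holds`, `not_Theorem41_of_example` — the AUTHORS' OWN Example
  §4.3: `u₀ = v₀ = w₀ = (x²+y²+z²)/(10+x⁴+y⁴+z⁴)` satisfies (P1) with `B = 1` (`p1_exampleDatum`, so the printed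
  sentence `Step_L14_Example` is TRUE), and its divergence at `(1,0,0)` is `18/121 + 0 + 0 ≠ 0`
  (`ex_pd0`, `ex_pd1`, `ex_pd2`), so (2) has no solution in the printed class from the Example's data, for any
  `ρ, ν`; with the skeleton's `example_instance` this refutes Theorem 4.1 on the paper's own certificate that
  non-solenoidal data are meant to be covered (print-faithful, not a junk instance).
* §3 `not_Theorem46` (Theorem 4.6 asserts existence for the same data class, so it dies identically) and
  `not_Theorem41_Theorem46_ClaimedTheorem : ¬ Theorem41 ∧ ¬ Theorem46 ∧ ¬ ClaimedTheorem`.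
Second locator (what the referee's obvious charity — adding `div(u₀,v₀,w₀) = 0` to (P1) — exposes): the
compactness device p.2979, `not_Step_L8_YCompact` in `SoloRefuteGeorgievDavidi2024Device{Witness,}.lean`
(typist-4 g2's kit, farm-checked by the refuter; the journal twin of C31's locator `not_Step4_compact` p479196).

WHAT THIS IS NOT: not a claim about NS regularity or blow-up; not a claim about any author beyond the
typed locator.
-/

-- The summit's canonical theorem namespace repeats the summit name (single-conjunct summit).
set_option linter.dupNamespace false

noncomputable section

namespace Summit.NavierStokesRegularity.NavierStokesRegularity.Theorems.GeorgievDavidi2024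

open Set Function Filter Topology
open Literature.Claims.NS.GeorgievDavidi2021 (pd)
open Literature.Claims.NS.GeorgievDavidi2024

/-- `ℝ³`. -/
abbrev E3 := EuclideanSpace ℝ (Fin 3)

/-! ## §1a Kit vocabulary (ns-claims-typist-4 g2, sha16 b9f14f86a77cb075, verbatim) -/

/-- The first coordinate as a continuous linear functional. -/
def proj0 : EuclideanSpace ℝ (Fin 3) →L[ℝ] ℝ := EuclideanSpace.proj (0 : Fin 3)

/-- `proj0 x = x 0`. -/
lemma proj0_apply (x : EuclideanSpace ℝ (Fin 3)) : proj0 x = x 0 := rfl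

/-- The (P1)-admissible datum `u₀(x,y,z) = 1 + sin x` (with `v₀ = w₀ = 0`, `B = 2`). -/
def u0 (x : EuclideanSpace ℝ (Fin 3)) : ℝ := 1 + Real.sin (x 0)

/-- `u₀` is smooth. -/
lemma u0_contDiff : ContDiff ℝ 2 u0 := by
  unfold u0
  exact contDiff_const.add (Real.contDiff_sin.comp (proj0.contDiff))

/-- `∂ₓu₀(0) = 1`. -/
lemma pd0_u0_zero : pd 0 u0 0 = 1 := by
  unfold pd u0
  have h1 : HasFDerivAt (fun x : EuclideanSpace ℝ (Fin 3) => x 0) proj0 0 := proj0.hasFDerivAt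
  have h2 : HasFDerivAt (fun x : EuclideanSpace ℝ (Fin 3) => Real.sin (x 0))
      (Real.cos ((0 : EuclideanSpace ℝ (Fin 3)) 0) • proj0) 0 :=
    (Real.hasDerivAt_sin _).comp_hasFDerivAt 0 h1
  have h3 : HasFDerivAt (fun x : EuclideanSpace ℝ (Fin 3) => 1 + Real.sin (x 0))
      (Real.cos ((0 : EuclideanSpace ℝ (Fin 3)) 0) • proj0) 0 := h2.const_add 1
  rw [h3.fderiv]
  simp [proj0_apply]

/-- `(u₀, 0, 0)` satisfies (P1) with `B = 2`. -/
lemma p1_u0 : P1 2 u0 0 0 := by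
  refine ⟨two_pos, u0_contDiff, contDiff_const, contDiff_const, fun x => ?_⟩
  have hs1 := Real.sin_le_one (x 0)
  have hs2 := Real.neg_one_le_sin (x 0)
  simp only [u0, Pi.zero_apply]
  refine ⟨by linarith, by linarith, le_rfl, by norm_num, le_rfl, by norm_num⟩

/-- The space derivative of the zero field vanishes. -/
lemma pd_zero (k : Fin 3) (x : EuclideanSpace ℝ (Fin 3)) :
    pd k (0 : EuclideanSpace ℝ (Fin 3) → ℝ) x = 0 := by
  unfold pd
  simp

/-- Continuity up to `t = 0` transports an identity from `(0,∞) × ℝ³` to `t = 0`: if `g` is continuous on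
`[0,∞) × ℝ³` and vanishes for `t > 0`, it vanishes at `t = 0`. -/
lemma eq_zero_at_zero {g : ℝ × EuclideanSpace ℝ (Fin 3) → ℝ} (hg : ContinuousOn g (Ici 0 ×ˢ univ))
    (h0 : ∀ t : ℝ, 0 < t → ∀ x, g (t, x) = 0) (x : EuclideanSpace ℝ (Fin 3)) : g (0, x) = 0 := by
  have hmaps : MapsTo (fun t : ℝ => (t, x)) (Ici 0) (Ici 0 ×ˢ univ) := fun t ht => ⟨ht, mem_univ _⟩
  have hf : ContinuousWithinAt (fun t : ℝ => (t, x)) (Ici 0) 0 :=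
    (continuous_id.prodMk continuous_const).continuousWithinAt
  have hc : ContinuousWithinAt (fun t : ℝ => g (t, x)) (Ici 0) 0 :=
    ContinuousWithinAt.comp (f := fun t : ℝ => (t, x)) (x := (0 : ℝ))
      (hg (0, x) (show ((0 : ℝ), x) ∈ Ici (0 : ℝ) ×ˢ (univ : Set (EuclideanSpace ℝ (Fin 3))) from
        ⟨self_mem_Ici, mem_univ _⟩)) hf hmaps
  have h1 : Tendsto (fun t : ℝ => g (t, x)) (𝓝[Ioi 0] 0) (𝓝 (g (0, x))) :=
    hc.tendsto.mono_left (nhdsWithin_mono _ Ioi_subset_Ici_self)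
  have h2 : Tendsto (fun t : ℝ => g (t, x)) (𝓝[Ioi 0] 0) (𝓝 0) := by
    refine tendsto_const_nhds.congr' ?_
    exact eventually_nhdsWithin_of_forall fun t ht => (h0 t ht x).symm
  exact tendsto_nhds_unique h1 h2

/-! ## §0 The structural fact: a non-solenoidal datum admits no solution of (2) in the printed class -/

/-- If `u₀ₓ + v₀_y + w₀_z ≠ 0` at some point `x`, then NO `(u,v,w,p) ∈ (C¹([0,∞), C²(ℝ³)))⁴` solves the IVP (2)
with data `(u₀,v₀,w₀)` (any `ρ, ν`): the divergence `uₓ + v_y + w_z` is jointly continuous on `[0,∞) × ℝ³`,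
vanishes on `(0,∞) × ℝ³`, hence at `(0, x)`, where it equals `u₀ₓ + v₀_y + w₀_z (x) ≠ 0`.
[cite: GeorgievDavidi2024, (2) p.2965; Thm 4.1 p.2977] -/
theorem not_solvesIVP2_of_div_ne_zero {ρ ν : ℝ} {u₀ v₀ w₀ : E3 → ℝ} (x : E3)
    (hx : pd 0 u₀ x + pd 1 v₀ x + pd 2 w₀ x ≠ 0) (u v w p : ℝ → E3 → ℝ) :
    ¬ SolvesIVP2 ρ ν u₀ v₀ w₀ u v w p := by
  intro hs
  set g : ℝ × E3 → ℝ := fun q => pd 0 (u q.1) q.2 + pd 1 (v q.1) q.2 + pd 2 (w q.1) q.2 with hgdef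
  have hg : ContinuousOn g (Ici 0 ×ˢ univ) :=
    ((hs.memU.cont1 0).add (hs.memV.cont1 1)).add (hs.memW.cont1 2)
  have h0 : ∀ t : ℝ, 0 < t → ∀ y, g (t, y) = 0 := fun t ht y => hs.div t ht y
  have hz := eq_zero_at_zero hg h0 x
  apply hx
  simpa [hgdef, hs.initU, hs.initV, hs.initW] using hz

/-! ## §1b Theorem 4.1 is false on the kit datum `u₀ = 1 + sin x`, `v₀ = w₀ = 0` (typist-4 g2's kit) -/

/-- **Theorem 4.1 as printed is false**: for the (P1)-datum `u₀ = 1 + sin x`, `v₀ = w₀ = 0` (`B = 2`) and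
`ρ = ν = 1` there is NO solution of (2) in `(C¹([0,∞), C²(ℝ³)))⁴` — the divergence of the datum at the origin is
`cos 0 = 1 ≠ 0` (§0). [cite: GeorgievDavidi2024, Thm 4.1 p.2977; (P1) p.2966; (2) p.2965] -/
theorem not_Theorem41 : ¬ Theorem41 := by
  intro h
  obtain ⟨u, v, w, p, hs⟩ := h 2 u0 0 0 p1_u0 1 1 one_pos one_pos
  refine not_solvesIVP2_of_div_ne_zero (ρ := 1) (ν := 1) 0 ?_ u v w p hs
  rw [pd0_u0_zero, pd_zero, pd_zero]
  norm_num

/-! ## §2 Theorem 4.1 is false on the authors' own Example §4.3 (p.2982) -/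

/-- The Example's denominator is positive. -/
lemma ex_den_pos (q : E3) : 0 < 10 + q 0 ^ 4 + q 1 ^ 4 + q 2 ^ 4 := by positivity

/-- `0 ≤ u₀` for the Example's datum. [cite: GeorgievDavidi2024, §4.3 p.2982] -/
lemma exampleDatum_nonneg (q : E3) : 0 ≤ exampleDatum q := by
  unfold exampleDatum
  exact div_nonneg (by positivity) (ex_den_pos q).le

/-- `u₀ ≤ 1` for the Example's datum (`x² ≤ x⁴ + 1`). [cite: GeorgievDavidi2024, §4.3 p.2982] -/
lemma exampleDatum_le_one (q : E3) : exampleDatum q ≤ 1 := by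
  unfold exampleDatum
  rw [div_le_one (ex_den_pos q)]
  nlinarith [sq_nonneg (q 0 ^ 2 - 1), sq_nonneg (q 1 ^ 2 - 1), sq_nonneg (q 2 ^ 2 - 1)]

/-- The coordinate `q ↦ q i` is smooth. -/
lemma ex_coord_contDiff (i : Fin 3) {n : WithTop ℕ∞} : ContDiff ℝ n (fun q : E3 => q i) :=
  contDiff_piLp_apply (𝕜 := ℝ) (p := 2) (n := n) (i := i)

/-- The Example's datum is `C²` (indeed smooth: a rational function with non-vanishing denominator).
[cite: GeorgievDavidi2024, §4.3 p.2982] -/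
lemma exampleDatum_contDiff : ContDiff ℝ 2 exampleDatum := by
  unfold exampleDatum
  refine ContDiff.div ?_ ?_ (fun q => (ex_den_pos q).ne')
  · exact (((ex_coord_contDiff 0).pow 2).add ((ex_coord_contDiff 1).pow 2)).add ((ex_coord_contDiff 2).pow 2)
  · exact ((contDiff_const.add ((ex_coord_contDiff 0).pow 4)).add ((ex_coord_contDiff 1).pow 4)).add
      ((ex_coord_contDiff 2).pow 4)

/-- The Example's data satisfy (P1) with `B = 1`. [cite: GeorgievDavidi2024, (P1) p.2966, §4.3 p.2982] -/
theorem p1_exampleDatum : P1 1 exampleDatum exampleDatum exampleDatum :=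
  ⟨one_pos, exampleDatum_contDiff, exampleDatum_contDiff, exampleDatum_contDiff, fun q =>
    ⟨exampleDatum_nonneg q, exampleDatum_le_one q, exampleDatum_nonneg q, exampleDatum_le_one q,
      exampleDatum_nonneg q, exampleDatum_le_one q⟩⟩

/-- Hence the printed sentence L14 («the IVP (2) satisfies all conditions of Theorem 4.1 and Theorem 4.6») is
TRUE as far as (P1) goes. [cite: GeorgievDavidi2024, §4.3 p.2982] -/
theorem step_L14_example_holds : Step_L14_Example := ⟨1, p1_exampleDatum⟩

/-- The point `(1, 0, 0)`. -/
def ex_pt : E3 := EuclideanSpace.single 0 1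

/-- A partial derivative is the derivative along the coordinate line: if `f` is differentiable at `a`,
`s ↦ f(a + s e_k)` agrees with `F`, and `F'(0) = v`, then `∂_k f(a) = v`. -/
lemma pd_eq_of_hasDerivAt_line {f : E3 → ℝ} {a : E3} {k : Fin 3} {F : ℝ → ℝ} {v : ℝ}
    (hf : DifferentiableAt ℝ f a) (hF : ∀ s, f (a + s • EuclideanSpace.single k (1 : ℝ)) = F s)
    (hv : HasDerivAt F v 0) : pd k f a = v := by
  have hγ : HasDerivAt (fun s : ℝ => a + s • EuclideanSpace.single k (1 : ℝ))
      (EuclideanSpace.single k (1 : ℝ)) 0 := by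
    simpa using ((hasDerivAt_id (0 : ℝ)).smul_const (EuclideanSpace.single k (1 : ℝ))).const_add a
  have hc := HasFDerivAt.comp_hasDerivAt_of_eq (0 : ℝ) hf.hasFDerivAt hγ (by simp)
  have hFF : (f ∘ fun s : ℝ => a + s • EuclideanSpace.single k (1 : ℝ)) = F := funext hF
  rw [hFF] at hc
  unfold pd
  exact hc.unique hv

/-- The Example's datum is differentiable. -/
lemma exampleDatum_differentiable : Differentiable ℝ exampleDatum :=
  exampleDatum_contDiff.differentiable two_ne_zero

/-- The Example's datum along the `x`-line through `(1,0,0)`. -/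
lemma ex_line0 (s : ℝ) :
    exampleDatum (ex_pt + s • EuclideanSpace.single 0 (1 : ℝ)) = (1 + s) ^ 2 / (10 + (1 + s) ^ 4) := by
  simp [exampleDatum, ex_pt]

/-- The Example's datum along the `y`-line through `(1,0,0)`. -/
lemma ex_line1 (s : ℝ) :
    exampleDatum (ex_pt + s • EuclideanSpace.single 1 (1 : ℝ)) = (1 + s ^ 2) / (11 + s ^ 4) := by
  simp [exampleDatum, ex_pt]
  ring

/-- The Example's datum along the `z`-line through `(1,0,0)`. -/
lemma ex_line2 (s : ℝ) :
    exampleDatum (ex_pt + s • EuclideanSpace.single 2 (1 : ℝ)) = (1 + s ^ 2) / (11 + s ^ 4) := by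
  simp [exampleDatum, ex_pt]
  ring

/-- `∂ₓu₀(1,0,0) = 18/121` for the Example's datum. [cite: GeorgievDavidi2024, §4.3 p.2982] -/
lemma ex_pd0 : pd 0 exampleDatum ex_pt = 18 / 121 := by
  have hN := ((hasDerivAt_id' (0 : ℝ)).const_add (1 : ℝ)).fun_pow 2
  have hD := (((hasDerivAt_id' (0 : ℝ)).const_add (1 : ℝ)).fun_pow 4).const_add (10 : ℝ)
  have hv := hN.fun_div hD (by norm_num)
  rw [pd_eq_of_hasDerivAt_line (exampleDatum_differentiable ex_pt) ex_line0 hv]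
  norm_num

/-- `∂_yu₀(1,0,0) = 0` for the Example's datum. [cite: GeorgievDavidi2024, §4.3 p.2982] -/
lemma ex_pd1 : pd 1 exampleDatum ex_pt = 0 := by
  have hN := ((hasDerivAt_id' (0 : ℝ)).fun_pow 2).const_add (1 : ℝ)
  have hD := ((hasDerivAt_id' (0 : ℝ)).fun_pow 4).const_add (11 : ℝ)
  have hv := hN.fun_div hD (by norm_num)
  rw [pd_eq_of_hasDerivAt_line (exampleDatum_differentiable ex_pt) ex_line1 hv]
  norm_num

/-- `∂_zu₀(1,0,0) = 0` for the Example's datum. [cite: GeorgievDavidi2024, §4.3 p.2982] -/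
lemma ex_pd2 : pd 2 exampleDatum ex_pt = 0 := by
  have hN := ((hasDerivAt_id' (0 : ℝ)).fun_pow 2).const_add (1 : ℝ)
  have hD := ((hasDerivAt_id' (0 : ℝ)).fun_pow 4).const_add (11 : ℝ)
  have hv := hN.fun_div hD (by norm_num)
  rw [pd_eq_of_hasDerivAt_line (exampleDatum_differentiable ex_pt) ex_line2 hv]
  norm_num

/-- The divergence of the Example's data `(u₀,u₀,u₀)` at `(1,0,0)` is `18/121 ≠ 0` (LIT1-FILOMAT §3's arithmetic,
now kernel-checked). [cite: GeorgievDavidi2024, §4.3 p.2982] -/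
theorem ex_div_ne_zero : pd 0 exampleDatum ex_pt + pd 1 exampleDatum ex_pt + pd 2 exampleDatum ex_pt ≠ 0 := by
  rw [ex_pd0, ex_pd1, ex_pd2]
  norm_num

/-- **The authors' Example refutes their Theorem 4.1**: for `u₀ = v₀ = w₀ = (x²+y²+z²)/(10+x⁴+y⁴+z⁴)` (p.2982:
«satisfies all conditions of Theorem 4.1 and Theorem 4.6») the IVP (2) has NO solution in
`(C¹([0,∞), C²(ℝ³)))⁴`, for any `ρ, ν`. [cite: GeorgievDavidi2024, §4.3 p.2982; Thm 4.1 p.2977; (2) p.2965] -/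
theorem example_not_solvable (ρ ν : ℝ) :
    ¬ ∃ u v w p : ℝ → E3 → ℝ, SolvesIVP2 ρ ν exampleDatum exampleDatum exampleDatum u v w p := by
  rintro ⟨u, v, w, p, hs⟩
  exact not_solvesIVP2_of_div_ne_zero ex_pt ex_div_ne_zero u v w p hs

/-- Theorem 4.1 refuted on the paper's own Example (via the skeleton's `example_instance`).
[cite: GeorgievDavidi2024, §4.3 p.2982; Thm 4.1 p.2977] -/
theorem not_Theorem41_of_example : ¬ Theorem41 := fun h =>
  example_not_solvable 1 1 (example_instance h step_L14_example_holds)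

/-! ## §3 Theorem 4.6 and the claimed theorem -/

/-- **Theorem 4.6 as printed is false** as well (it asserts, in particular, existence of a solution of (2) in the
printed class for every (P1)-datum; the Example's datum has none). [cite: GeorgievDavidi2024, Thm 4.6 p.2981] -/
theorem not_Theorem46 : ¬ Theorem46 := by
  intro h
  obtain ⟨u, v, w, p, _, _, _, _, hs, -, -⟩ := h 1 _ _ _ p1_exampleDatum 1 1 one_pos one_pos
  exact example_not_solvable 1 1 ⟨u, v, w, p, hs⟩

/-- Hence the claimed theorem (Theorem 4.1 ∧ Theorem 4.6) is false — each conjunct separately (stated as one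
conjunction: the bare `¬ ClaimedTheorem` text is shared with other claim files and is not re-declared).
[cite: GeorgievDavidi2024, §4 p.2977–2981] -/
theorem not_Theorem41_Theorem46_ClaimedTheorem : ¬ Theorem41 ∧ ¬ Theorem46 ∧ ¬ ClaimedTheorem :=
  ⟨not_Theorem41, not_Theorem46, fun h => not_Theorem41 h.1⟩

end Summit.NavierStokesRegularity.NavierStokesRegularity.Theorems.GeorgievDavidi2024

end
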